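import Literature.Geometry.Lorentzian.KillingDevelopmentGlobalisation
import Literature.Geometry.Lorentzian.GluedTimeOrientation
import Literature.Geometry.Lorentzian.CurvatureNaturality
import Literature.Geometry.Lorentzian.DocStationarySpacetime
import Literature.Geometry.Lorentzian.KillingFieldOnNaturality
import Literature.Geometry.Lorentzian.Einstein
import HarnessLib

/-!
# Killing development on an open region of a vacuum spacetime: assembly from the local step
# (Moncrief 1975, §III; Fischer–Marsden–Moncrief 1980, Lemma 2.2)

The globalisation theorem `IsCauchyHypersurface.exists_isKillingFieldOn_univ_of_localStep`
(`KillingDevelopmentGlobalisation`) is stated for a connected time-oriented `C^∞` Lorentzian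
manifold with a Cauchy hypersurface. The named fact
`Literature.Geometry.Lorentzian.fischerMarsdenMoncrief_killing_development`
(`KillingDevelopment.lean`) concerns instead an open region `G` of a vacuum `Spacetime 4` with a
Cauchy hypersurface `Sc` of `(G, g|_G, τ|_G)`, and a Killing field `ξ` on an open `U`,
`Sc ⊆ U ⊆ G`. This file performs the transfer (`Spacetime.killing_development_of_localStep`):

* `G` need not be connected; its connected components `V` (open, and closed in `G`) inherit the
  Cauchy hypersurface `Sc ∩ V` (`IsCauchyHypersurface.restrict_of_le_of_closure`: an endless
  timelike curve of `V` is endless in `G`, an endpoint in `G` lying in `closure V ∩ G = V`);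
* the restricted metric `g|_V` is Ricci-flat (`PseudoRiemannianMetric.isRicciFlat_restrict`,
  naturality of the Ricci tensor under the inclusion, `ricci_comap_apply` with `dι = id`);
* Killing fields of `g` on an open `W` restrict to Killing fields of `g|_V` on `ι ⁻¹' W`
  (`IsKillingFieldOn.restrict_subtypeVal`, from `IsKillingFieldOn.comap_mpullback`), and a
  Killing field of `g|_V` on all of `V` is a Killing field of `g` on the open set `V`
  (`isKillingFieldOn_of_isKillingFieldOn_restrict_univ`: smoothness by
  `OpenSubmanifold.contMDiffAt_tangentSection_of_restrict`, the Killing equation by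
  `leviCivita_restrict_apply_of_mdifferentiableAt`, `∇^{g|V} = ∇^g` along the inclusion);
* the Killing fields produced on the components are glued over `G` (`IsKillingFieldOn.of_locally`).

The remaining hypothesis of `Spacetime.killing_development_of_localStep` is the LOCAL
CONTINUATION STEP for connected Ricci-flat `C^∞` time-oriented Lorentzian 4-manifolds (the PDE
content of Moncrief's theorem: the wave equation `□ξ' + Ric·ξ' = 0` and the homogeneous wave
equation for the deformation tensor of `ξ'` in vacuum), in the form consumed by the
globalisation theorem. All results here are proved; no definitions, no named facts (D-0026).

## References

* V. Moncrief, *Spacetime symmetries and linearization stability of the Einstein equations. I*,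
  J. Math. Phys. 16 (1975) 493–498, §III.
* A. E. Fischer, J. E. Marsden, V. Moncrief, Ann. Inst. H. Poincaré A 33 (1980) 147–194,
  Lemma 2.2.
* B. O'Neill, *Semi-Riemannian geometry*, Academic Press 1983, Ch. 3, p. 57 and Prop. 3.59
  (open submanifolds, naturality of the connection); Ch. 9, Prop. 9.25; Ch. 14, Def. 14.28.
-/

noncomputable section

open Bundle Set Filter Function Topology TopologicalSpace VectorField
open scoped Manifold ContDiff Topology

namespace Literature.Geometry.Lorentzian

/-! ### Cauchy hypersurfaces pass to relatively closed open sub-spacetimes -/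

section CauchyRestrict

variable {E : Type*} [NormedAddCommGroup E] [NormedSpace ℝ E] {H : Type*} [TopologicalSpace H]
  {I : ModelWithCorners ℝ E H} {n : ℕ∞ω} {M : Type*} [TopologicalSpace M] [ChartedSpace H M]
  [IsManifold I ∞ M] {g : LorentzianMetric I n M} {τ : TimeOrientation g}

/-- **A Cauchy hypersurface of an open sub-spacetime `W` is one of every open `V ⊆ W` which is
closed in `W`** (e.g. a union of connected components of `W`): an endless timelike curve of `V`
is a timelike curve of `W`; an endpoint of it in `W` would lie in `closure V ∩ W ⊆ V` and be an
endpoint in `V`. So the curve is endless in `W` and meets `S` exactly once. O'Neill 1983, Ch. 14,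
Def. 14.28 (Cauchy hypersurfaces of open submanifolds).
[cite: ONeillSemiRiemannian1983, Ch. 14, Def. 28 (p. 415)] -/
theorem LorentzianMetric.IsCauchyHypersurface.restrict_of_le_of_closure
    (hres : PseudoRiemannianMetric.contMDiff_restrict (I := I) (n := n) (M := M))
    (hτ : τ.contMDiff_restrict) {S : Set M} {V W : Opens M} (hVW : V ≤ W)
    (hcl : closure (V : Set M) ∩ W ⊆ V)
    (hW : (g.restrict hres W).IsCauchyHypersurface (τ.restrict hres hτ W) (Subtype.val ⁻¹' S)) :
    (g.restrict hres V).IsCauchyHypersurface (τ.restrict hres hτ V) (Subtype.val ⁻¹' S) := by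
  intro γ s hγ
  obtain ⟨hs, hγt, hγf, hγp⟩ := hγ
  set γW : ℝ → W := fun t ↦ ⟨(γ t).1, hVW (γ t).2⟩ with hγW
  have hγM : g.IsFutureTimelikeCurveOn τ (Subtype.val ∘ γ) s :=
    (LorentzianMetric.isFutureTimelikeCurveOn_restrict_iff g τ hres hτ V).1 hγt
  have hγWt : (g.restrict hres W).IsFutureTimelikeCurveOn (τ.restrict hres hτ W) γW s :=
    (LorentzianMetric.isFutureTimelikeCurveOn_restrict_iff g τ hres hτ W).2 hγM
  haveI : Nonempty s := hγf.1.to_subtype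
  -- an endpoint of `γ` in `W` lies in `closure V ∩ W ⊆ V`
  have hmemV : ∀ p : W, (HasFutureEndpoint γW s p ∨ HasPastEndpoint γW s p) → (p : M) ∈ V := by
    rintro p hp
    refine hcl ⟨?_, p.2⟩
    rcases hp with hp | hp
    · exact mem_closure_of_tendsto (hasFutureEndpoint_subtypeVal_comp_iff.2 hp)
        (Eventually.of_forall fun t ↦ (γ t).2)
    · exact mem_closure_of_tendsto (hasPastEndpoint_subtypeVal_comp_iff.2 hp)
        (Eventually.of_forall fun t ↦ (γ t).2)
  have hfe : IsFutureEndless γW s := by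
    refine ⟨hγf.1, fun p hp ↦ ?_⟩
    have hpV : (p : M) ∈ V := hmemV p (Or.inl hp)
    have hpM : HasFutureEndpoint (Subtype.val ∘ γ) s (p : M) :=
      hasFutureEndpoint_subtypeVal_comp_iff.2 hp
    exact hγf.2 ⟨p, hpV⟩ ((hasFutureEndpoint_subtypeVal_comp_iff (p := (⟨p, hpV⟩ : V))).1 hpM)
  have hpe : IsPastEndless γW s := by
    refine ⟨hγp.1, fun p hp ↦ ?_⟩
    have hpV : (p : M) ∈ V := hmemV p (Or.inr hp)
    have hpM : HasPastEndpoint (Subtype.val ∘ γ) s (p : M) :=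
      hasPastEndpoint_subtypeVal_comp_iff.2 hp
    exact hγp.2 ⟨p, hpV⟩ ((hasPastEndpoint_subtypeVal_comp_iff (p := (⟨p, hpV⟩ : V))).1 hpM)
  obtain ⟨t, ⟨hts, htS⟩, huniq⟩ := hW γW s ⟨hs, hγWt, hfe, hpe⟩
  exact ⟨t, ⟨hts, htS⟩, fun t' ht' ↦ huniq t' ht'⟩

end CauchyRestrict

/-! ### Killing fields and Ricci-flatness along the inclusion of an open submanifold -/

section Restrict

variable {d : ℕ} {M : Type*} [TopologicalSpace M] [ChartedSpace (EuclideanSpace ℝ (Fin d)) M]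
  [IsManifold (𝓡 d) ∞ M]

namespace PseudoRiemannianMetric

/-- Equal metrics have the same Killing fields on a set (whatever the proofs of the standing
Levi-Civita hypothesis). [folklore] -/
theorem isKillingFieldOn_congr_metric {E : Type*} [NormedAddCommGroup E] [NormedSpace ℝ E]
    {H : Type*} [TopologicalSpace H] {I : ModelWithCorners ℝ E H} {X : Type*}
    [TopologicalSpace X] [ChartedSpace H X] [IsManifold I ∞ X] {n : ℕ∞ω}
    {g₁ g₂ : PseudoRiemannianMetric I n E (TangentSpace I : X → Type _)} (h : g₁ = g₂)
    (i₁ : g₁.HasLeviCivita) (i₂ : g₂.HasLeviCivita) (K : Π x : X, TangentSpace I x) (A : Set X) :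
    g₁.IsKillingFieldOn K A ↔ g₂.IsKillingFieldOn K A := by
  subst h; rfl

/-- Equal metrics have equal Levi-Civita connections (pointwise, instances explicit).
[folklore] -/
private theorem leviCivita_congr_metric_aux {E : Type*} [NormedAddCommGroup E]
    [NormedSpace ℝ E] {H : Type*} [TopologicalSpace H] {I : ModelWithCorners ℝ E H} {X : Type*}
    [TopologicalSpace X] [ChartedSpace H X] [IsManifold I ∞ X] {n : ℕ∞ω}
    {g₁ g₂ : PseudoRiemannianMetric I n E (TangentSpace I : X → Type _)} (h : g₁ = g₂)
    (i₁ : g₁.HasLeviCivita) (i₂ : g₂.HasLeviCivita) (K : Π x : X, TangentSpace I x) (x : X) :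
    g₁.leviCivita K x = g₂.leviCivita K x := by
  subst h; rfl

variable (g : PseudoRiemannianMetric (𝓡 d) ∞ (EuclideanSpace ℝ (Fin d)) (TangentSpace (𝓡 d) : M → Type _))
  [g.HasLeviCivita] (U : Opens M)
  [(g.restrict PseudoRiemannianMetric.contMDiff_restrict_holds U).HasLeviCivita]

/-- **Killing fields on an open set restrict to the open submanifold.** If `Z` is a Killing field
of `g` on the open set `W ⊆ M`, then `Z ∘ ι` is a Killing field of `g|_U` on `ι ⁻¹' W` for every
open `U` (`g|_U = ι^* g`, `restrict_eq_comap`; `Z ∘ ι = ι^* Z`, `mpullback_subtypeVal`; Killing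
fields on open sets pull back, `IsKillingFieldOn.comap_mpullback`). O'Neill 1983, Ch. 9,
Prop. 9.25 with Ch. 3, p. 57. [cite: ONeillSemiRiemannian1983, Ch. 9, Prop. 25 (p. 251)] -/
theorem IsKillingFieldOn.restrict_subtypeVal {Z : Π x : M, TangentSpace (𝓡 d) x} {W : Set M}
    (hW : IsOpen W) (hZ : g.IsKillingFieldOn Z W) :
    (g.restrict PseudoRiemannianMetric.contMDiff_restrict_holds U).IsKillingFieldOn
      (fun y : U ↦ (Z y.1 : TangentSpace (𝓡 d) y)) ((Subtype.val : U → M) ⁻¹' W) := by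
  set gc := g.comap PseudoRiemannianMetric.contMDiff_pullbackBilin_holds (Subtype.val : U → M)
    contMDiff_subtype_val (injective_mfderiv_subtypeVal U) rfl with hgc_def
  haveI hgcLC : gc.HasLeviCivita := gc.hasLeviCivita
  have hgc : g.restrict PseudoRiemannianMetric.contMDiff_restrict_holds U = gc :=
    PseudoRiemannianMetric.restrict_eq_comap g U
  have key : gc.IsKillingFieldOn (mpullback (𝓡 d) (𝓡 d) (Subtype.val : U → M) Z)
      ((Subtype.val : U → M) ⁻¹' W) :=
    PseudoRiemannianMetric.IsKillingFieldOn.comap_mpullback g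
      PseudoRiemannianMetric.contMDiff_pullbackBilin_holds contMDiff_subtype_val
      (injective_mfderiv_subtypeVal U) rfl hW hZ
  rw [mpullback_subtypeVal] at key
  exact (isKillingFieldOn_congr_metric hgc inferInstance hgcLC _ _).2 key

/-- **The connection restricts: `∇^{g|U}_v (K ∘ ι)(y) = ∇^g_v K (ι y)`** for a section `K`
differentiable at `ι y` (naturality of the Levi-Civita connection under the inclusion,
`leviCivita_comap_mpullback_apply`, with `dι = id`). O'Neill 1983, Ch. 3, Prop. 3.59 and p. 57.
[cite: ONeillSemiRiemannian1983, Ch. 3, Prop. 59 (p. 90)] -/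
theorem leviCivita_restrict_apply_of_mdifferentiableAt {K : Π x : M, TangentSpace (𝓡 d) x}
    (y : U) (hK : MDifferentiableAt (𝓡 d) (𝓡 d).tangent
      (fun x ↦ (TotalSpace.mk' (EuclideanSpace ℝ (Fin d)) x (K x) : TangentBundle (𝓡 d) M)) y.1)
    (v : TangentSpace (𝓡 d) y) :
    (g.restrict PseudoRiemannianMetric.contMDiff_restrict_holds U).leviCivita
        (fun y : U ↦ (K y.1 : TangentSpace (𝓡 d) y)) y v = g.leviCivita K y.1 v := by
  set gc := g.comap PseudoRiemannianMetric.contMDiff_pullbackBilin_holds (Subtype.val : U → M)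
    contMDiff_subtype_val (injective_mfderiv_subtypeVal U) rfl with hgc_def
  haveI hgcLC : gc.HasLeviCivita := gc.hasLeviCivita
  have hgc : g.restrict PseudoRiemannianMetric.contMDiff_restrict_holds U = gc :=
    PseudoRiemannianMetric.restrict_eq_comap g U
  rw [leviCivita_congr_metric_aux hgc inferInstance hgcLC, ← mpullback_subtypeVal U K,
    g.leviCivita_comap_mpullback_apply PseudoRiemannianMetric.contMDiff_pullbackBilin_holds
      contMDiff_subtype_val (injective_mfderiv_subtypeVal U) rfl hK v,
    inverse_mfderiv_subtypeVal_apply, mfderiv_subtypeVal_apply]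

/-- **A Killing field of the open submanifold is a Killing field on the open set.** If `ζ` is a
Killing field of `g|_U` on all of `U` and `Z` is any section of `TM` with `Z (ι y) = ζ y`, then
`Z` is a Killing field of `g` on `U`: it is smooth at the points of `U`
(`OpenSubmanifold.contMDiffAt_tangentSection_of_restrict`) and satisfies the Killing equation
there because `∇^g Z (ι y) = ∇^{g|U} ζ (y)` (`leviCivita_restrict_apply_of_mdifferentiableAt`)
and `g_{ι y} = (g|_U)_y`. O'Neill 1983, Ch. 9, Def. 9.22 (Killing fields of open submanifolds).
[cite: ONeillSemiRiemannian1983, Ch. 9, Def. 22 (p. 250)] -/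
theorem isKillingFieldOn_of_isKillingFieldOn_restrict_univ {ζ : Π y : U, TangentSpace (𝓡 d) y}
    (hζ : (g.restrict PseudoRiemannianMetric.contMDiff_restrict_holds U).IsKillingFieldOn ζ univ)
    {Z : Π x : M, TangentSpace (𝓡 d) x} (hZ : ∀ y : U, Z y.1 = ζ y) :
    g.IsKillingFieldOn Z U := by
  have hfun : (fun y : U ↦ (Z y.1 : TangentSpace (𝓡 d) y)) = ζ := funext hZ
  have hsmooth : ∀ x ∈ (U : Set M), ContMDiffAt (𝓡 d) (𝓡 d).tangent ∞
      (fun x ↦ (TotalSpace.mk' (EuclideanSpace ℝ (Fin d)) x (Z x) : TangentBundle (𝓡 d) M))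
      x := fun x hx ↦ by
    refine OpenSubmanifold.contMDiffAt_tangentSection_of_restrict (V := Z) U ⟨x, hx⟩ ?_
    have heq : (fun y : U ↦ (TotalSpace.mk' (EuclideanSpace ℝ (Fin d)) y (Z y.1) :
        TangentBundle (𝓡 d) U)) = fun y : U ↦ TotalSpace.mk' (EuclideanSpace ℝ (Fin d)) y (ζ y) := by
      funext y; rw [hZ y]
    rw [heq]
    exact hζ.contMDiffAt isOpen_univ (mem_univ _)
  refine ⟨fun x hx ↦ (hsmooth x hx).contMDiffWithinAt, fun x hx Y₀ W₀ ↦ ?_⟩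
  have hmd : MDifferentiableAt (𝓡 d) (𝓡 d).tangent
      (fun x ↦ (TotalSpace.mk' (EuclideanSpace ℝ (Fin d)) x (Z x) : TangentBundle (𝓡 d) M)) x :=
    (hsmooth x hx).mdifferentiableAt (by simp)
  have h1 := leviCivita_restrict_apply_of_mdifferentiableAt g U ⟨x, hx⟩ hmd
  have hK := hζ.val_leviCivita_add (mem_univ (⟨x, hx⟩ : U)) Y₀ W₀
  rw [← hfun, h1 Y₀, h1 W₀] at hK
  exact hK

omit [(g.restrict PseudoRiemannianMetric.contMDiff_restrict_holds U).HasLeviCivita] in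
/-- **The Ricci tensor restricts: `Ric^{g|U}_y (v, w) = Ric^g_{ι y} (v, w)`** (naturality of the
Ricci tensor under the inclusion, `ricci_comap_apply`, `dι = id`). O'Neill 1983, Ch. 3,
Prop. 3.59. [cite: ONeillSemiRiemannian1983, Ch. 3, Prop. 59 (p. 90)] -/
theorem ricci_restrict_apply [(g.restrict PseudoRiemannianMetric.contMDiff_restrict_holds U).HasLeviCivita]
    (y : U) (v w : TangentSpace (𝓡 d) y) :
    (g.restrict PseudoRiemannianMetric.contMDiff_restrict_holds U).ricci y v w =
      g.ricci y.1 v w := by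
  set gc := g.comap PseudoRiemannianMetric.contMDiff_pullbackBilin_holds (Subtype.val : U → M)
    contMDiff_subtype_val (injective_mfderiv_subtypeVal U) rfl with hgc_def
  haveI hgcLC : gc.HasLeviCivita := gc.hasLeviCivita
  have hgc : g.restrict PseudoRiemannianMetric.contMDiff_restrict_holds U = gc :=
    PseudoRiemannianMetric.restrict_eq_comap g U
  rw [ricci_congr_metric hgc inferInstance hgcLC,
    g.ricci_comap_apply PseudoRiemannianMetric.contMDiff_pullbackBilin_holds contMDiff_subtype_val
      (injective_mfderiv_subtypeVal U) rfl y v w,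
    mfderiv_subtypeVal_apply, mfderiv_subtypeVal_apply]

/-- **Vacuum restricts**: the restriction of a Ricci-flat metric to an open submanifold is
Ricci-flat. O'Neill 1983, Ch. 3, Prop. 3.59. [cite: ONeillSemiRiemannian1983, Ch. 3, Prop. 59 (p. 90)] -/
theorem isRicciFlat_restrict (hvac : g.IsRicciFlat) :
    (g.restrict PseudoRiemannianMetric.contMDiff_restrict_holds U).IsRicciFlat := by
  intro y
  ext v w
  rw [ricci_restrict_apply g U y v w, hvac y.1]
  rfl

end PseudoRiemannianMetric

end Restrict

/-! ### The assembly -/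

/-- **Moncrief's Killing development on an open region of a vacuum spacetime, from the local
continuation step.** Assume the LOCAL CONTINUATION STEP for every connected Ricci-flat `C^∞`
time-oriented Lorentzian 4-manifold `(M, g, τ)`: for every `p₀ ∈ M`, every `f`, `C^∞` on an open
`O ∋ p₀` with `f p₀ = 0` and `df_r(v) > 0` for `r ∈ O` and future-directed `v`, every Killing
field on `{f < 0} ∩ O` agrees on `{f < 0} ∩ N` with a Killing field of some open `N`,
`p₀ ∈ N ⊆ O`. Then in a Ricci-flat `Spacetime 4`, for every open region `G` with a Cauchy
hypersurface `Sc` of `(G, g|_G, τ|_G)` and every Killing field `ξ` on an open `U`,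
`Sc ⊆ U ⊆ G`, there is a Killing field `ξ'` on `G` equal to `ξ` on an open `U'`,
`Sc ⊆ U' ⊆ U` — the statement of
`Literature.Geometry.Lorentzian.fischerMarsdenMoncrief_killing_development`. Proof: apply the
globalisation theorem `IsCauchyHypersurface.exists_isKillingFieldOn_univ_of_localStep` on each
connected component `V` of `G` (with Cauchy hypersurface `Sc ∩ V`, Ricci-flat metric `g|_V`, the
restricted Killing field `ξ ∘ ι`), push the resulting Killing fields of `g|_V` forward to `g` on
`V` and glue over the components. Moncrief 1975, §III; Fischer–Marsden–Moncrief 1980, Lemma 2.2.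
[cite: Moncrief1975, §III] [cite: FischerMarsdenMoncrief1980, Lemma 2.2 (pp. 161–162)] -/
theorem Spacetime.killing_development_of_localStep
    (hPDE : ∀ {M : Type} [TopologicalSpace M] [ChartedSpace (EuclideanSpace ℝ (Fin 4)) M]
      [IsManifold (𝓡 4) ∞ M] [T2Space M] [SecondCountableTopology M] [ConnectedSpace M]
      (g : LorentzianMetric (𝓡 4) ∞ M) [g.toPseudoRiemannianMetric.HasLeviCivita],
      g.toPseudoRiemannianMetric.IsRicciFlat → ∀ (τ : TimeOrientation g)
      (p₀ : M) (O : Set M) (f : M → ℝ), IsOpen O → p₀ ∈ O →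
      ContMDiffOn (𝓡 4) 𝓘(ℝ, ℝ) ∞ f O → f p₀ = 0 →
      (∀ r ∈ O, ∀ v : TangentSpace (𝓡 4) r, τ.IsFutureDirected v →
        (0 : ℝ) < mfderiv (𝓡 4) 𝓘(ℝ, ℝ) f r v) →
      ∀ ζ : Π x : M, TangentSpace (𝓡 4) x,
        g.IsKillingFieldOn ζ {r | r ∈ O ∧ f r < 0} →
      ∃ N : Set M, IsOpen N ∧ p₀ ∈ N ∧ N ⊆ O ∧
        ∃ ζ' : Π x : M, TangentSpace (𝓡 4) x, g.IsKillingFieldOn ζ' N ∧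
          ∀ r ∈ N, f r < 0 → ζ' r = ζ r) :
    ∀ (𝒮 : Literature.Geometry.Lorentzian.Spacetime.{0} 4)
      [𝒮.metric.toPseudoRiemannianMetric.HasLeviCivita],
      𝒮.metric.toPseudoRiemannianMetric.IsRicciFlat →
      ∀ (G : TopologicalSpace.Opens 𝒮.carrier) (U Sc : Set 𝒮.carrier)
        (ξ : (y : 𝒮.carrier) → TangentSpace (modelWithCornersSelf ℝ (EuclideanSpace ℝ (Fin 4))) y),
      (𝒮.metric.restrict Literature.Geometry.Lorentzian.PseudoRiemannianMetric.contMDiff_restrict_holds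
          G).IsCauchyHypersurface
        (𝒮.timeOrientation.restrict
          Literature.Geometry.Lorentzian.PseudoRiemannianMetric.contMDiff_restrict_holds
          𝒮.timeOrientation.contMDiff_restrict_holds G) (Subtype.val ⁻¹' Sc) →
      Sc ⊆ U → IsOpen U → U ⊆ (G : Set 𝒮.carrier) → 𝒮.metric.IsKillingFieldOn ξ U →
      ∃ ξ' : (y : 𝒮.carrier) → TangentSpace (modelWithCornersSelf ℝ (EuclideanSpace ℝ (Fin 4))) y,
        𝒮.metric.IsKillingFieldOn ξ' (G : Set 𝒮.carrier) ∧
        ∃ U' : Set 𝒮.carrier, IsOpen U' ∧ Sc ⊆ U' ∧ U' ⊆ U ∧ ∀ y ∈ U', ξ' y = ξ y := by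
  intro 𝒮 _ hRic G U Sc ξ hSc hScU hU hUG hξ
  classical
  -- notation
  set cr := (Literature.Geometry.Lorentzian.PseudoRiemannianMetric.contMDiff_restrict_holds
    (I := 𝓡 4) (n := ∞) (M := 𝒮.carrier)) with hcr
  set cτ := 𝒮.timeOrientation.contMDiff_restrict_holds with hcτ
  haveI : LocallyConnectedSpace 𝒮.carrier :=
    ChartedSpace.locallyConnectedSpace (EuclideanSpace ℝ (Fin 4)) 𝒮.carrier
  -- Step 1: the theorem on one component `V` of `G` (an open `V ≤ G`, connected, closed in `G`)
  have key : ∀ V : Opens 𝒮.carrier, IsConnected (V : Set 𝒮.carrier) → V ≤ G →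
      closure (V : Set 𝒮.carrier) ∩ G ⊆ V →
      ∃ Z : Π x : 𝒮.carrier, TangentSpace (𝓡 4) x, 𝒮.metric.IsKillingFieldOn Z V ∧
        ∃ V₀ : Set 𝒮.carrier, IsOpen V₀ ∧ Sc ∩ V ⊆ V₀ ∧ V₀ ⊆ U ∩ V ∧ ∀ y ∈ V₀, Z y = ξ y := by
    intro V hVc hVG hcl
    haveI : ConnectedSpace V := isConnected_iff_connectedSpace.1 hVc
    haveI : LocallyConnectedSpace V :=
      ChartedSpace.locallyConnectedSpace (EuclideanSpace ℝ (Fin 4)) V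
    set gV : LorentzianMetric (𝓡 4) ∞ V := 𝒮.metric.restrict cr V with hgV
    haveI hLC : gV.toPseudoRiemannianMetric.HasLeviCivita :=
      gV.toPseudoRiemannianMetric.hasLeviCivita
    haveI hLC' : (𝒮.metric.toPseudoRiemannianMetric.restrict cr V).HasLeviCivita := hLC
    haveI : Fact ((1 : ℕ∞ω) ≤ ∞) := ⟨by exact_mod_cast le_top⟩
    haveI : CovariantDerivative.ContMDiffCovariantDerivative gV.leviCivita 1 :=
      ⟨gV.toPseudoRiemannianMetric.isLocallyContMDiff_leviCivita_holds 1
        (by rw [show ((1 : ℕ∞) : ℕ∞ω) + 1 = 2 by norm_num]; exact WithTop.coe_le_coe.2 le_top)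
        univ isOpen_univ⟩
    set τV : TimeOrientation gV := 𝒮.timeOrientation.restrict cr cτ V with hτV
    -- vacuum, Cauchy hypersurface and Killing field on the component
    have hRicV : gV.toPseudoRiemannianMetric.IsRicciFlat :=
      PseudoRiemannianMetric.isRicciFlat_restrict 𝒮.metric.toPseudoRiemannianMetric V hRic
    have hCauchyV : gV.IsCauchyHypersurface τV (Subtype.val ⁻¹' Sc) :=
      LorentzianMetric.IsCauchyHypersurface.restrict_of_le_of_closure cr cτ hVG hcl hSc
    have hξV : gV.IsKillingFieldOn (fun y : V ↦ (ξ y.1 : TangentSpace (𝓡 4) y))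
        ((Subtype.val : V → 𝒮.carrier) ⁻¹' U) :=
      PseudoRiemannianMetric.IsKillingFieldOn.restrict_subtypeVal
        𝒮.metric.toPseudoRiemannianMetric V hU hξ
    -- the globalisation theorem on `V`
    obtain ⟨ζ, hζ, V₀, hV₀o, hSV₀, hV₀U, hζξ⟩ :=
      LorentzianMetric.IsCauchyHypersurface.exists_isKillingFieldOn_univ_of_localStep τV
        Literature.Geometry.Lorentzian.PseudoRiemannianMetric.contMDiff_restrict_holds
        τV.contMDiff_restrict_holds hCauchyV (hPDE gV hRicV)
        (hU.preimage continuous_subtype_val) (fun y hy ↦ hScU hy) hξV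
    -- push forward to `𝒮.carrier`
    let Z : Π x : 𝒮.carrier, TangentSpace (𝓡 4) x := fun x ↦
      if h : x ∈ (V : Set 𝒮.carrier) then (ζ ⟨x, h⟩ : EuclideanSpace ℝ (Fin 4)) else 0
    have hZV : ∀ y : V, Z y.1 = ζ y := fun y ↦ by
      have hy : (y : 𝒮.carrier) ∈ (V : Set 𝒮.carrier) := y.2
      simp only [Z, dif_pos hy]
    have hZ : 𝒮.metric.IsKillingFieldOn Z V :=
      PseudoRiemannianMetric.isKillingFieldOn_of_isKillingFieldOn_restrict_univ
        𝒮.metric.toPseudoRiemannianMetric V hζ hZV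
    refine ⟨Z, hZ, Subtype.val '' V₀, V.isOpen.isOpenMap_subtype_val _ hV₀o, ?_, ?_, ?_⟩
    · rintro s ⟨hsS, hsV⟩
      exact ⟨⟨s, hsV⟩, hSV₀ (show (⟨s, hsV⟩ : V) ∈ Subtype.val ⁻¹' Sc from hsS), rfl⟩
    · rintro _ ⟨y, hy, rfl⟩
      exact ⟨hV₀U hy, y.2⟩
    · rintro _ ⟨y, hy, rfl⟩
      rw [hZV y]
      exact hζξ y hy
  -- Step 2: the components of `G`
  choose Zof hZof V₀of hV₀o hSV₀ hV₀U hZξ using key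
  let comp : 𝒮.carrier → Set 𝒮.carrier := fun z ↦ connectedComponentIn (G : Set 𝒮.carrier) z
  have hcomp_open : ∀ z, IsOpen (comp z) := fun z ↦ G.isOpen.connectedComponentIn
  let Vc : 𝒮.carrier → Opens 𝒮.carrier := fun z ↦ ⟨comp z, hcomp_open z⟩
  have hVc_conn : ∀ z ∈ (G : Set 𝒮.carrier), IsConnected ((Vc z : Opens 𝒮.carrier) : Set 𝒮.carrier) :=
    fun z hz ↦ ⟨⟨z, mem_connectedComponentIn hz⟩, isPreconnected_connectedComponentIn⟩
  have hVc_le : ∀ z, Vc z ≤ G := fun z y hy ↦ connectedComponentIn_subset _ _ hy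
  have hVc_cl : ∀ z, closure ((Vc z : Opens 𝒮.carrier) : Set 𝒮.carrier) ∩ G ⊆ Vc z := by
    rintro z y ⟨hycl, hyG⟩
    -- the component of `y` is a neighbourhood of `y`, hence meets `comp z`
    have hny : connectedComponentIn (G : Set 𝒮.carrier) y ∈ 𝓝 y :=
      connectedComponentIn_mem_nhds (G.isOpen.mem_nhds hyG)
    obtain ⟨w, hwy, hwz⟩ := mem_closure_iff_nhds.1 hycl _ hny
    have h1 : connectedComponentIn (G : Set 𝒮.carrier) y =
        connectedComponentIn (G : Set 𝒮.carrier) w := connectedComponentIn_eq hwy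
    have h2 : connectedComponentIn (G : Set 𝒮.carrier) z =
        connectedComponentIn (G : Set 𝒮.carrier) w := connectedComponentIn_eq hwz
    show y ∈ connectedComponentIn (G : Set 𝒮.carrier) z
    rw [h2, ← h1]
    exact mem_connectedComponentIn hyG
  -- equal components give equal chosen fields
  have hcast : ∀ {V V' : Opens 𝒮.carrier} (e : V = V') (p : IsConnected (V : Set 𝒮.carrier))
      (q : V ≤ G) (r : closure (V : Set 𝒮.carrier) ∩ G ⊆ V)
      (p' : IsConnected (V' : Set 𝒮.carrier)) (q' : V' ≤ G)
      (r' : closure (V' : Set 𝒮.carrier) ∩ G ⊆ V'),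
      Zof V p q r = Zof V' p' q' r' ∧ V₀of V p q r = V₀of V' p' q' r' := by
    intro V V' e p q r p' q' r'
    subst e
    exact ⟨rfl, rfl⟩
  have hVc_eq : ∀ {z w : 𝒮.carrier}, w ∈ comp z → Vc w = Vc z := fun {z w} hw ↦ by
    ext1
    exact (connectedComponentIn_eq hw).symm
  -- the glued field
  let ξ' : Π x : 𝒮.carrier, TangentSpace (𝓡 4) x := fun z ↦
    if h : z ∈ (G : Set 𝒮.carrier) then Zof (Vc z) (hVc_conn z h) (hVc_le z) (hVc_cl z) z else 0
  have hξ'_eq : ∀ z (hz : z ∈ (G : Set 𝒮.carrier)), ∀ w ∈ comp z,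
      ξ' w = Zof (Vc z) (hVc_conn z hz) (hVc_le z) (hVc_cl z) w := by
    intro z hz w hw
    have hwG : w ∈ (G : Set 𝒮.carrier) := connectedComponentIn_subset _ _ hw
    have h1 : ξ' w = Zof (Vc w) (hVc_conn w hwG) (hVc_le w) (hVc_cl w) w := by
      simp only [ξ', dif_pos hwG]
    rw [h1, (hcast (hVc_eq hw) (hVc_conn w hwG) (hVc_le w) (hVc_cl w) (hVc_conn z hz)
      (hVc_le z) (hVc_cl z)).1]
  have hξ' : 𝒮.metric.IsKillingFieldOn ξ' (G : Set 𝒮.carrier) := by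
    refine PseudoRiemannianMetric.IsKillingFieldOn.of_locally fun z hz ↦ ?_
    exact ⟨comp z, Zof (Vc z) (hVc_conn z hz) (hVc_le z) (hVc_cl z), hcomp_open z,
      mem_connectedComponentIn hz, hZof _ _ _ _, hξ'_eq z hz⟩
  -- the open set `U'`
  let U' : Set 𝒮.carrier := ⋃ z, ⋃ h : z ∈ (G : Set 𝒮.carrier),
    V₀of (Vc z) (hVc_conn z h) (hVc_le z) (hVc_cl z)
  have hU'o : IsOpen U' := isOpen_iUnion fun z ↦ isOpen_iUnion fun h ↦ hV₀o _ _ _ _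
  refine ⟨ξ', hξ', U', hU'o, fun s hs ↦ ?_, ?_, ?_⟩
  · have hsG : s ∈ (G : Set 𝒮.carrier) := hUG (hScU hs)
    exact mem_iUnion.2 ⟨s, mem_iUnion.2 ⟨hsG,
      hSV₀ _ _ _ _ ⟨hs, mem_connectedComponentIn hsG⟩⟩⟩
  · intro w hw
    obtain ⟨z, hw⟩ := mem_iUnion.1 hw
    obtain ⟨hz, hw⟩ := mem_iUnion.1 hw
    exact (hV₀U _ _ _ _ hw).1
  · intro w hw
    obtain ⟨z, hw⟩ := mem_iUnion.1 hw
    obtain ⟨hz, hw⟩ := mem_iUnion.1 hw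
    have hwc : w ∈ comp z := (hV₀U _ _ _ _ hw).2
    rw [hξ'_eq z hz w hwc]
    exact hZξ _ _ _ _ w hw

end Literature.Geometry.Lorentzian

end
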